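import Summits.BirchSwinnertonDyer.BirchSwinnertonDyer.Theorems.ResidualThetaTransportAtTwoHeckeThetaPartnerAdicAtTwoHeckeThetaNebentypus
import Literature.NumberTheory.QuadraticFields.QuadraticDedekindZeta
import Literature.NumberTheory.QuadraticFields.KroneckerCharacterEvenDiscriminant
import Literature.NumberTheory.QuadraticFields.JacobiCharacterPrimitiveProofs
import Literature.NumberTheory.EllipticCurves.CMNewformOfHeckeCharacterProofs
import Mathlib.NumberTheory.NumberField.Discriminant.Basic
import HarnessLib

/-!
# The Kronecker character of an imaginary quadratic field and the splitting of primes (toward K0⁺, stmt-20690)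

Route `ResidualThetaTransportAtTwo`, crux K0⁺ `HeckeThetaPartnerAdicAtTwo` (stmt-BirchSwinnertonDyer-20690),
line "Hecke theta series from the genus-two Riemann theta function".  THEOREMS ONLY (glue).

* `discr_lt_zero_of_isTotallyComplex` — `d_K < 0` for a totally complex quadratic field;
* `exists_kroneckerChar_imQuad` — a primitive odd quadratic character `κ` mod `|d_K|` with
  `κ(n) = (d_K/n)` for odd `n` and `ζ_K = ζ · L(κ)` (tree: `jacobiChar` for odd `d_K`,
  `exists_kroneckerChar_of_four_dvd` for even `d_K`);
* `kroneckerChar_eq_of_pair` / `kroneckerChar_eq_of_singleton` — the decomposition law read off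
  the COUNT of ideals of norm `p`: `1 + κ(p) = #{𝔞 : N𝔞 = p}` (`idealNormCount_eq_sum_divisors`),
  which is `2` at a split and `0` at an inert prime;
* `idealPow_span_prime_eq` — `ψ̃((p)) = κ(p) p` for a prime `p ∤ |d_K| M` under the crux
  hypothesis (from `kappa_mul_chi_eq_one`).

BSD is not proved by this file.
-/

set_option autoImplicit false
set_option linter.dupNamespace false

noncomputable section

open scoped NumberField ComplexConjugate Real NumberTheorySymbols
open NumberField Module Complex IsDedekindDomain

namespace Summit.BirchSwinnertonDyer.BirchSwinnertonDyer.Theorems.HeckeTheta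

open Literature.NumberTheory.LFunctions (idealPow rayClassCoeff idealNormCount)
open Literature.NumberTheory.QuadraticFields (jacobiChar jacobiChar_natCast isPrimitive_jacobiChar
  isQuadratic_jacobiChar jacobiChar_neg_one_of_mod_four_eq_three jacobiSym_natAbs_eq_of_emod_four_eq_one)
open Literature.NumberTheory.QuadraticFields.Quadratic (isFundamentalDiscriminant_discr
  dedekindZeta_eq_riemannZeta_mul_LSeries exists_kroneckerChar_of_four_dvd)
open Literature.NumberTheory.EllipticCurves.ModularForms (setOf_absNorm_eq_of_pair
  setOf_absNorm_eq_of_singleton)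

variable {K : Type} [Field K] [NumberField K]

/-! ### The sign of the discriminant -/

/-- **`d_K < 0`** for a totally complex quadratic field (`sign d_K = (-1)^{r₂}`, `r₂ = 1`). -/
theorem discr_lt_zero_of_isTotallyComplex (hK : finrank ℚ K = 2) [IsTotallyComplex K] :
    NumberField.discr K < 0 := by
  have h := NumberField.sign_discr (K := K)
  have hr : InfinitePlace.nrComplexPlaces K = 1 := by
    have := NumberField.IsTotallyComplex.finrank (K := K)
    omega
  rw [hr, pow_one] at h
  exact Int.sign_eq_neg_one_iff_neg.mp h

/-! ### The Kronecker character -/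

/-- **The Kronecker character of an imaginary quadratic field**: a primitive, odd, quadratic
Dirichlet character `κ` mod `|d_K|` with `κ(n) = (d_K/n)` (Jacobi symbol) for odd `n` and
`ζ_K(s) = ζ(s) L(s, κ)` for `Re s > 1`. -/
theorem exists_kroneckerChar_imQuad (hK : finrank ℚ K = 2) [IsTotallyComplex K] :
    ∃ κ : DirichletCharacter ℂ (NumberField.discr K).natAbs,
      κ.IsPrimitive ∧ κ.Odd ∧ κ ^ 2 = 1 ∧
      (∀ n : ℕ, Odd n → κ n = (jacobiSym (NumberField.discr K) n : ℂ)) ∧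
      ∀ s : ℂ, 1 < s.re →
        NumberField.dedekindZeta K s = riemannZeta s * LSeries (fun n => κ n) s := by
  have hneg := discr_lt_zero_of_isTotallyComplex hK
  rcases isFundamentalDiscriminant_discr (K := K) hK with ⟨h1, hsq, -⟩ | ⟨h4, -, -⟩
  · -- odd discriminant: the Jacobi character mod `|d_K|`
    have hodd : Odd (NumberField.discr K) := by rw [Int.odd_iff]; omega
    have hoddD : Odd (NumberField.discr K).natAbs := Int.natAbs_odd.mpr hodd
    have hsqD : Squarefree (NumberField.discr K).natAbs := Int.squarefree_natAbs.mpr hsq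
    have h3 : (NumberField.discr K).natAbs % 4 = 3 := by omega
    refine ⟨jacobiChar (NumberField.discr K).natAbs, isPrimitive_jacobiChar hoddD hsqD,
      jacobiChar_neg_one_of_mod_four_eq_three h3, isQuadratic_jacobiChar.sq_eq_one,
      fun n hn => ?_, fun s hs => dedekindZeta_eq_riemannZeta_mul_LSeries hK hodd hs⟩
    rw [jacobiChar_natCast, jacobiSym_natAbs_eq_of_emod_four_eq_one h1 hn]
  · -- even discriminant
    obtain ⟨κ, hprim, hquad, -, hval, -, hodd, hζ⟩ := exists_kroneckerChar_of_four_dvd hK h4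
    exact ⟨κ, hprim, hodd hneg, hquad.sq_eq_one, fun n hn => hval n hn.pos.ne', hζ⟩

/-! ### The decomposition law from the count of ideals of prime norm -/

/-- `#{𝔞 : N𝔞 = p} = 1 + κ(p)` for a prime `p`. -/
theorem idealNormCount_prime_eq {κ : DirichletCharacter ℂ (NumberField.discr K).natAbs}
    (hζ : ∀ s : ℂ, 1 < s.re → NumberField.dedekindZeta K s = riemannZeta s * LSeries (fun n => κ n) s)
    {p : ℕ} (hp : p.Prime) : (idealNormCount K p : ℂ) = 1 + κ p := by
  rw [idealNormCount_eq_sum_divisors (κ := fun n => κ n) (fun m => κ.norm_le_one _) hζ hp.ne_zero,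
    hp.divisors, Finset.sum_pair hp.one_lt.ne]
  simp

/-- `#{𝔞 : N𝔞 = p}` as the cardinality of the set of ideals of norm `p`. -/
theorem idealNormCount_eq_ncard (n : ℕ) :
    idealNormCount K n = ({I : Ideal (𝓞 K) | Ideal.absNorm I = n} : Set (Ideal (𝓞 K))).ncard := by
  rw [idealNormCount, ← Nat.card_coe_set_eq]
  rfl

/-- **Split prime: `κ(p) = 1`.**  If the places of `K` above `v` are a pair `w₁ ≠ w₂` of residue
degree one, then `κ(p_v) = 1` (two ideals of norm `p`). -/
theorem kroneckerChar_eq_of_pair {κ : DirichletCharacter ℂ (NumberField.discr K).natAbs}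
    (hζ : ∀ s : ℂ, 1 < s.re → NumberField.dedekindZeta K s = riemannZeta s * LSeries (fun n => κ n) s)
    (v : HeightOneSpectrum (𝓞 ℚ)) {w₁ w₂ : HeightOneSpectrum (𝓞 K)} (hne : w₁ ≠ w₂)
    (hS : {w : HeightOneSpectrum (𝓞 K) | w.asIdeal.under (𝓞 ℚ) = v.asIdeal} = {w₁, w₂})
    (h₁ : w₁.asIdeal.inertiaDeg (𝓞 ℚ) = 1) (h₂ : w₂.asIdeal.inertiaDeg (𝓞 ℚ) = 1) :
    κ (Rat.HeightOneSpectrum.natGenerator v) = 1 := by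
  have hp := Rat.HeightOneSpectrum.prime_natGenerator v
  have hcount := idealNormCount_prime_eq hζ hp
  rw [idealNormCount_eq_ncard, setOf_absNorm_eq_of_pair v hS h₁ h₂,
    Set.ncard_pair (fun h => hne (HeightOneSpectrum.ext h))] at hcount
  norm_num at hcount
  linear_combination -hcount

/-- **Inert prime: `κ(p) = -1`.**  If the only place of `K` above `v` has residue degree two, then
`κ(p_v) = -1` (no ideal of norm `p`). -/
theorem kroneckerChar_eq_of_singleton {κ : DirichletCharacter ℂ (NumberField.discr K).natAbs}
    (hζ : ∀ s : ℂ, 1 < s.re → NumberField.dedekindZeta K s = riemannZeta s * LSeries (fun n => κ n) s)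
    (v : HeightOneSpectrum (𝓞 ℚ)) {w : HeightOneSpectrum (𝓞 K)}
    (hS : {w : HeightOneSpectrum (𝓞 K) | w.asIdeal.under (𝓞 ℚ) = v.asIdeal} = {w})
    (hw : w.asIdeal.inertiaDeg (𝓞 ℚ) = 2) :
    κ (Rat.HeightOneSpectrum.natGenerator v) = -1 := by
  have hp := Rat.HeightOneSpectrum.prime_natGenerator v
  have hcount := idealNormCount_prime_eq hζ hp
  rw [idealNormCount_eq_ncard, setOf_absNorm_eq_of_singleton v hS hw, Set.ncard_empty] at hcount
  norm_num at hcount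
  linear_combination -hcount

/-! ### `ψ̃((p)) = κ(p) p` -/

/-- **`ψ̃((p)) = κ(p) · p`** for a prime `p ∤ |d_K| M`, from `κ(p) χ(p) = 1`
(`kappa_mul_chi_eq_one`) and `κ(p)² = 1`. -/
theorem idealPow_span_prime_eq (hK : finrank ℚ K = 2) (σ : K →+* ℂ)
    {κ : DirichletCharacter ℂ (NumberField.discr K).natAbs} (hκodd : κ.Odd) (hquad : κ ^ 2 = 1)
    (hκJ : ∀ n : ℕ, Odd n → κ n = (jacobiSym (NumberField.discr K) n : ℂ))
    {𝔪 : Ideal (𝓞 K)} (h𝔪 : 𝔪 ≠ ⊥) {ψ : HeightOneSpectrum (𝓞 K) → ℂ}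
    (hψ : ∀ b c : 𝓞 K, b ≠ 0 → c ≠ 0 → IsCoprime (Ideal.span {c}) 𝔪 → b - c ∈ 𝔪 →
      idealPow K ψ (Ideal.span {b}) = idealPow K ψ (Ideal.span {c}) * σ ((b : K) / c))
    (hneb : ∀ n : ℕ, Odd n → n.Coprime ((NumberField.discr K).natAbs * Ideal.absNorm 𝔪) →
      idealPow K ψ (Ideal.span {(n : 𝓞 K)}) = (jacobiSym (NumberField.discr K) n : ℂ) * (n : ℂ))
    {p : ℕ} (hp : p.Prime) (hpN : ¬ p ∣ (NumberField.discr K).natAbs * Ideal.absNorm 𝔪) :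
    idealPow K ψ (Ideal.span {(p : 𝓞 K)}) = κ p * p := by
  classical
  have hcop : p.Coprime ((NumberField.discr K).natAbs * Ideal.absNorm 𝔪) :=
    (Nat.Prime.coprime_iff_not_dvd hp).mpr hpN
  have h := kappa_mul_chi_eq_one hK σ hκodd hκJ h𝔪 hψ hneb (d := (p : ℤ))
    (by exact_mod_cast Nat.Coprime.isCoprime hcop)
  -- `rcc((p)) = ψ̃((p))`
  have hne : Ideal.span {(p : 𝓞 K)} ≠ ⊥ := by
    rw [Ne, Ideal.span_singleton_eq_bot]; exact_mod_cast hp.ne_zero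
  have hcopM : IsCoprime (Ideal.span {(p : 𝓞 K)}) 𝔪 :=
    isCoprime_span_natCast (Nat.Coprime.coprime_mul_left_right hcop)
  have hrcc : rayClassCoeff 𝔪 ψ (Ideal.span {((p : ℤ) : 𝓞 K)}) = idealPow K ψ (Ideal.span {(p : 𝓞 K)}) := by
    rw [Int.cast_natCast, rayClassCoeff, if_pos ⟨hne, hcopM⟩]
  have hσ : σ ((((p : ℤ) : 𝓞 K)) : K) = (p : ℂ) := by simp
  rw [hrcc, hσ, Int.cast_natCast] at h
  -- `κ(p)² = 1`
  have hκp : κ p * κ p = 1 := by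
    have hu : IsUnit (p : ZMod (NumberField.discr K).natAbs) :=
      (ZMod.isUnit_iff_coprime p _).mpr (Nat.Coprime.coprime_mul_right_right hcop)
    have := congrArg (fun χ : DirichletCharacter ℂ (NumberField.discr K).natAbs => χ (p : ZMod _)) hquad
    simp only [MulChar.pow_apply' _ two_ne_zero, MulChar.one_apply hu] at this
    rw [← sq]; exact this
  have hp0 : (p : ℂ) ≠ 0 := by exact_mod_cast hp.ne_zero
  have h' : κ p * idealPow K ψ (Ideal.span {(p : 𝓞 K)}) = p := by
    have := congrArg (fun z => z * (p : ℂ)) h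
    simp only [one_mul] at this
    rw [← this]; field_simp
  calc idealPow K ψ (Ideal.span {(p : 𝓞 K)})
      = (κ p * κ p) * idealPow K ψ (Ideal.span {(p : 𝓞 K)}) := by rw [hκp, one_mul]
    _ = κ p * (κ p * idealPow K ψ (Ideal.span {(p : 𝓞 K)})) := by ring
    _ = κ p * p := by rw [h']

end Summit.BirchSwinnertonDyer.BirchSwinnertonDyer.Theorems.HeckeTheta

end
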